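import Summits.ResolutionOfSingularities.ResolutionOfSingularities.Theorems.FrobeniusLadderFInjectiveMacaulayficationFCUnguardedDimFourOfAbsorbingStep
import Summits.ResolutionOfSingularities.ResolutionOfSingularities.Theorems.FrobeniusLadderFInjectiveMacaulayficationReductions
import Literature.AlgebraicGeometry.Resolution.SurfaceResolutionReduction
import Literature.AlgebraicGeometry.Dimension.FibreLocalRingDimension
import HarnessLib

/-!
# THE DIM-4 SLICE OF THE CRUX: an F-injective Cohen–Macaulay model of every integral variety of dimension ≤ 4, from the Cossart–Piltant package
# and the dim-4 closed-point step (L4) — assembly (iii) of res-L1-w45a-plan-1 RULING R16.65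
# (crux `FInjectiveMacaulayfication` stmt-ResolutionOfSingularities-15315, chain w45a; seat res-L1-w45a-lead-1 g7)

[OURS · L1 W4.5a] Support file (`--supports stmt-ResolutionOfSingularities-15315 --as helper`); replaces the role of NO printed item; NOT a statement of
the manuscript; def-free; THEOREMS modulo `CossartPiltant2019General` (CP 2019 Thm. 1.1 (i)(ii)), `Stacks081R` (Raynaud–Gruson 5.2.2),
`CossartPiltant2019Principalization` (CP 2019 Prop. 4.4) BY NAME, and modulo the F-TEMKIN STEP AT THE CLOSED RESIDUAL POINTS taken as the HYPOTHESIS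
`hii` (= the output of res-L1-w45a-stub-2's `…FTemkinClosedPoints`, which derives it from the candidate (L4) `LocalFullificationDimFour` of OURS);
AI-written (AI review is weaker than expert review).

THE DIM-4 SLICE. For an integral separated `k`-scheme `X` of finite type:
* `dim X ≤ 3`: Cossart–Piltant's printed theorem (`CossartPiltant2019General`) gives a resolution `X′ → X`; regular stalks are FULL
  (`RegularPointClause.fiClause_stalk_of_isRegularLocalRing`) — `fiModel_integral_of_dim_le_three`.
* `dim X = 4`: THEOREM A(4) (`FCUnguardedDimFourOfAbsorbingStep.regularOffFinite_dimFour`, from the U-line's p557070: one blowing up `X′ → X`, centre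
  in `Sing X`, regular off a finite set `F` of closed points; `dim 𝒪_{X,b} = 4` at `b ∈ F` by the dimension formula
  `coheight_add_height_eq_topologicalKrullDim`) followed by the F-TEMKIN step `hii` («for such `(X′, f, J, F)` there is a blowing up `X″ → X` along
  some `J″ ≠ ⊥` that is FULL at every point» — stub-2's induction on `F` from (L4)), and a blowing up of an integral scheme along `J″ ≠ ⊥` is proper,
  birational with integral source (`IsBlowup.isProper/isBirational'/isIntegral`) — `fiModel_integral_dimFour_of_step`.
Together: **`fiModel_integral_dimLe4_of_step`** = the right-hand side of `Reductions.fInjectiveMacaulayfication_iff_integral` (the crux in its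
INTEGRAL form) for every `X` of dimension `≤ 4`, modulo the CP package and `hii`. The reduced form follows by the tree's component gluing
(`exists_fiModel_of_integralForm`) once `hii` is available for all components — not restated here.
[folklore assembly; cite: CossartPiltant2019, Thm. 1.1; Temkin2008, Prop. 2.3.4; Matsumura1987, Thm. 17.4; Kunz1969, Thm. 2.1]
-/

-- single-problem summit: the doubled namespace component is forced
set_option linter.dupNamespace false

noncomputable section

namespace Summit.ResolutionOfSingularities.ResolutionOfSingularities.Theorems.FInjectiveMacaulayfication.FInjectiveMacaulayficationDimFour

open CategoryTheory CategoryTheory.Limits AlgebraicGeometry TopologicalSpace IsLocalRing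
open Literature.AlgebraicGeometry.Resolution
open Summit.ResolutionOfSingularities.ResolutionOfSingularities.Theorems.FInjectiveMacaulayfication
open SliceableCentre FCUnguardedAprime

/-! ## §1 Dimension ≤ 3: Cossart–Piltant outright -/

/-- **An integral variety of dimension `≤ 3` has a FULL proper birational model** (Cossart–Piltant 2019 Thm. 1.1 BY NAME; regular ⇒ FULL).
[OURS · conditional-result] [cite: CossartPiltant2019, Thm. 1.1 (i)(ii)] [cite: Matsumura1987, Thm. 17.4] [cite: Kunz1969, Thm. 2.1] -/
theorem fiModel_integral_of_dim_le_three (hG : CossartPiltant2019General.{0})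
    (p : ℕ) [Fact p.Prime] (k : Type) [Field k] [CharP k p] (X : Scheme.{0}) (f : X ⟶ Spec (.of k))
    [IsSeparated f] [LocallyOfFiniteType f] [QuasiCompact f] [IsIntegral X] (h3 : topologicalKrullDim X ≤ 3) :
    ∃ (X' : Scheme.{0}) (π : X' ⟶ X), IsProper π ∧ IsBirational π ∧ IsIntegral X' ∧ ∀ x : X', FullCl p (X'.presheaf.stalk x) := by
  haveI : IsNoetherian X := ClosedPointsOfClosedFinite.isNoetherian_of_locallyOfFiniteType_of_quasiCompact f
  haveI : X.IsSeparated := Scheme.isSeparated_of_isSeparated_over f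
  have hqe : Scheme.IsQuasiExcellent X := Scheme.isQuasiExcellent_of_locallyOfFiniteType Stacks07QW_field_holds f
  obtain ⟨X', π, hπ, -, -, -⟩ := hG X hqe h3
  have hfull : ∀ x : X', FullCl p (X'.presheaf.stalk x) := fun x =>
    RegularPointClause.fiClause_stalk_of_isRegularLocalRing p (π ≫ f) x (hπ.isRegular x)
  exact ⟨X', π, hπ.isProper, hπ.isBirational,
    isIntegral_of_isBirational_of_isDomain_stalk hπ.isBirational (fun x => (hfull x).1), hfull⟩

/-! ## §2 Dimension 4: THEOREM A(4) followed by the F-Temkin step at the closed residual points -/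

/-- A CLOSED point of an integral `k`-variety of dimension `d` has local dimension `d` (dimension formula
`coheight x + height x = dim X`, with `height x = 0` at a closed point). [folklore; cite: GortzWedhorn2020, Thm. 5.22] -/
theorem ringKrullDim_stalk_of_isClosed {k : Type} [Field k] {X : Scheme.{0}} [IsIntegral X] (f : X ⟶ Spec (.of k))
    [LocallyOfFiniteType f] {d : ℕ} (hd : topologicalKrullDim X = d) {b : X} (hb : IsClosed ({b} : Set X)) :
    ringKrullDim (X.presheaf.stalk b) = d := by
  haveI : IsLocallyNoetherian X := LocallyOfFiniteType.isLocallyNoetherian f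
  have hform := Literature.AlgebraicGeometry.Dimension.coheight_add_height_eq_topologicalKrullDim f b
  rw [hd] at hform
  have hform' : Order.coheight b + Order.height b = d := by exact_mod_cast hform
  -- a closed point is minimal for specialisation, so `height b = 0`
  have hmin : IsMin b := by
    intro y hy
    have hby : b ⤳ y := Scheme.le_iff_specializes.mp hy
    have hy' : y ∈ closure ({b} : Set X) := specializes_iff_mem_closure.mp hby
    rw [hb.closure_eq, Set.mem_singleton_iff] at hy'
    rw [hy']
  have hh : Order.height b = 0 := Order.height_eq_zero.mpr hmin
  rw [hh, add_zero] at hform'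
  rw [ringKrullDim_stalk_eq_coheight, hform']
  rfl

/-- **Dimension 4: a FULL proper birational model from THEOREM A(4) and the F-Temkin step `hii` at the closed residual points.**
[OURS · conditional-result: CP package BY NAME + `hii`] [cite: Temkin2008, Prop. 2.3.4] [cite: CossartPiltant2019, Thm. 1.1; Prop. 4.4] -/
theorem fiModel_integral_dimFour_of_step
    (hG : CossartPiltant2019General.{0}) (h081R : Stacks081R.{0}) (hP : CossartPiltant2019Principalization.{0})
    (p : ℕ) [Fact p.Prime] (k : Type) [Field k] [CharP k p] (X : Scheme.{0}) (f : X ⟶ Spec (.of k))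
    [IsSeparated f] [LocallyOfFiniteType f] [QuasiCompact f] [IsIntegral X] (h4 : topologicalKrullDim X = 4)
    (hii : ∀ (X' : Scheme.{0}) (g : X' ⟶ X) (J : X.IdealSheafData) (F : Set X), IsBlowup g J →
      (J.support : Set X) ⊆ (Scheme.regularLocus X)ᶜ → IsClosed F → F.Finite → (∀ b ∈ F, IsClosed ({b} : Set X)) →
      (∀ b ∈ F, ringKrullDim (X.presheaf.stalk b) = 4) → (∀ x' : X', g x' ∉ F → x' ∈ Scheme.regularLocus X') →
      ∃ (X'' : Scheme.{0}) (g'' : X'' ⟶ X) (J'' : X.IdealSheafData), J'' ≠ ⊥ ∧ IsBlowup g'' J'' ∧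
        ∀ x'' : X'', FullCl p (X''.presheaf.stalk x'')) :
    ∃ (X' : Scheme.{0}) (π : X' ⟶ X), IsProper π ∧ IsBirational π ∧ IsIntegral X' ∧ ∀ x : X', FullCl p (X'.presheaf.stalk x) := by
  haveI : IsLocallyNoetherian X := LocallyOfFiniteType.isLocallyNoetherian f
  have h3 : (3 : WithBot ℕ∞) ≤ topologicalKrullDim X := by rw [h4]; exact_mod_cast (by norm_num : (3 : ℕ) ≤ 4)
  obtain ⟨X', g, J, F, hg, hJ, hFcl, hFfin, hFpts, hreg⟩ :=
    FCUnguardedDimFourOfAbsorbingStep.regularOffFinite_dimFour hG h081R hP f h3 h4.le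
  have hdim : ∀ b ∈ F, ringKrullDim (X.presheaf.stalk b) = 4 := fun b hb =>
    ringKrullDim_stalk_of_isClosed f h4 (hFpts b hb)
  obtain ⟨X'', g'', J'', hJ'', hg'', hfull⟩ := hii X' g J F hg hJ hFcl hFfin hFpts hdim hreg
  haveI : IsIntegral X'' := hg''.isIntegral hJ''
  exact ⟨X'', g'', hg''.isProper, hg''.isBirational' hJ'', inferInstance, hfull⟩

/-! ## §3 The dim ≤ 4 slice of the crux (integral form) -/

/-- **THE DIM-4 SLICE OF THE CRUX, INTEGRAL FORM**: every integral separated `k`-variety of dimension `≤ 4` has a proper birational integral model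
all of whose local rings are FULL (domain ∧ CM-clause ∧ Frobenius-closed parameter ideals) — the right-hand side of
`Reductions.fInjectiveMacaulayfication_iff_integral` for `X` — modulo the Cossart–Piltant package BY NAME and the F-Temkin step `hii` at closed
points of local dimension 4 (derived by res-L1-w45a-stub-2 from the candidate (L4) `LocalFullificationDimFour`). [OURS · conditional-result]
[cite: CossartPiltant2019, Thm. 1.1; Prop. 4.4] [cite: Temkin2008, Prop. 2.3.4] -/
theorem fiModel_integral_dimLe4_of_step
    (hG : CossartPiltant2019General.{0}) (h081R : Stacks081R.{0}) (hP : CossartPiltant2019Principalization.{0})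
    (p : ℕ) [Fact p.Prime] (k : Type) [Field k] [CharP k p] (X : Scheme.{0}) (f : X ⟶ Spec (.of k))
    [IsSeparated f] [LocallyOfFiniteType f] [QuasiCompact f] [IsIntegral X] (h4 : topologicalKrullDim X ≤ 4)
    (hii : ∀ (X' : Scheme.{0}) (g : X' ⟶ X) (J : X.IdealSheafData) (F : Set X), IsBlowup g J →
      (J.support : Set X) ⊆ (Scheme.regularLocus X)ᶜ → IsClosed F → F.Finite → (∀ b ∈ F, IsClosed ({b} : Set X)) →
      (∀ b ∈ F, ringKrullDim (X.presheaf.stalk b) = 4) → (∀ x' : X', g x' ∉ F → x' ∈ Scheme.regularLocus X') →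
      ∃ (X'' : Scheme.{0}) (g'' : X'' ⟶ X) (J'' : X.IdealSheafData), J'' ≠ ⊥ ∧ IsBlowup g'' J'' ∧
        ∀ x'' : X'', FullCl p (X''.presheaf.stalk x'')) :
    ∃ (X' : Scheme.{0}) (π : X' ⟶ X), IsProper π ∧ IsBirational π ∧ IsIntegral X' ∧ ∀ x : X', FullCl p (X'.presheaf.stalk x) := by
  by_cases h3 : topologicalKrullDim X ≤ 3
  · exact fiModel_integral_of_dim_le_three hG p k X f h3
  · have h4' : topologicalKrullDim X = 4 := by
      -- `dim X ≤ 4` and `¬ dim X ≤ 3`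
      have h := h4
      induction hD : topologicalKrullDim X using WithBot.recBotCoe with
      | bot => rw [hD] at h3; exact absurd bot_le h3
      | coe a =>
        rw [hD] at h h3
        induction a using ENat.recTopCoe with
        | top => exact absurd (WithBot.coe_le_coe.mp h) (by simp)
        | coe n =>
          have hn : n ≤ 4 := by exact_mod_cast (WithBot.coe_le_coe.mp h)
          have hn' : ¬ n ≤ 3 := fun hle =>
            h3 (WithBot.coe_le_coe.mpr (by exact_mod_cast hle : (n : ℕ∞) ≤ (3 : ℕ∞)))
          have : n = 4 := by omega
          subst this
          rfl
    exact fiModel_integral_dimFour_of_step hG h081R hP p k X f h4' hii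

end Summit.ResolutionOfSingularities.ResolutionOfSingularities.Theorems.FInjectiveMacaulayfication.FInjectiveMacaulayficationDimFour

end
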